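import Summits.Ventures.AbcSig.Rows.TemplateAB
import Summits.Ventures.AbcSig.Levels.N347
import Summits.Ventures.AbcSig.Levels.N694

/-!
# Venture AbcSig — ROW `C2aL347A6AB`: `347^m·xⁿ + 2^a·yⁿ = z²` (SECOND coefficient distribution of the cell; the distribution `xⁿ + 2^a·347^m·yⁿ = z²` is `Rows/C2aL347A6.lean`), class `a ge6` (GENERATED by plean/leanrow.py)

HONEST FRAMING. A row of a COMPUTATION cell (`pub-abcsig`); a CONDITIONAL theorem, no claim on ABC or any summit.
Hypotheses: `BS04Package` (CITED), `DataComplete` at levels [347, 694] (COMPUTED, two-engine certified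
level files), and the listed per-orbit exclusions `hX_…` (CITED — e.g. the cell's M6 Eisenstein certificates; the
row's R5 cell names each). Everything else is kernel-checked (`Rows/TemplateAB.lean`, `Levels/N….lean` — the SAME level files as the first distribution). Exponent
range: prime `n ≥ 11`, `n ≠ 347`; `B = 2^a 347^m` with `a, m < n` (n-th-power free).

-/

namespace Summit.Ventures.AbcSig

/-- Row `C2aL347A6AB`: second coefficient distribution `347^m·xⁿ + 2^a·yⁿ = z²` (see module docstring). -/
theorem row_C2aL347A6AB (M : NewformModel) (hP : M.BS04Package)
    (hD347 : M.DataComplete 347 level347Orbits) (hD694 : M.DataComplete 694 level694Orbits)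
    (n : ℕ) (hn : n.Prime) (hmin : 11 ≤ n) (hnℓ : n ≠ 347) (a m : ℕ) (ha : 6 ≤ a) (hm : 1 ≤ m) (han : a < n) (hmn : m < n)
    (hX_orbit_347_4 : n ∈ ([173] : List ℕ) → M.Excludes 347 orbit_347_4 (famAB (347 ^ m) (2 ^ a) n (fun _ _ => True)))
    (hX_orbit_694_4 : n ∈ ([29] : List ℕ) → M.Excludes 694 orbit_694_4 (famAB (347 ^ m) (2 ^ a) n (fun _ _ => True)))
    (x y z : ℤ) (hxy1 : x * y ≠ 1) (hxy2 : x * y ≠ -1) : ¬ IsPrimitiveSolution (347 ^ m) (2 ^ a) 1 n x y z := by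
  have hℓ : Nat.Prime 347 := by norm_num
  have h7 : 7 ≤ n := by omega
  have hS347 :=
    (level347_sieve n hn h7 (fun o => M.Excludes 347 o (famAB (347 ^ m) (2 ^ a) n (fun _ _ => True))) hX_orbit_347_4)
  have hS694 :=
    (level694_sieve n hn h7 (fun o => M.Excludes 694 o (famAB (347 ^ m) (2 ^ a) n (fun _ _ => True))) (fun h => absurd h (by simp only [List.mem_cons, List.not_mem_nil, or_false]; omega)) (fun h => absurd h (by simp only [List.mem_cons, List.not_mem_nil, or_false]; omega)) hX_orbit_694_4)
  by_cases ha6 : a = 6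
  · subst ha6
    exact rowC2aAB_a6 347 hℓ (by norm_num) M hP n hn h7 hnℓ hD347 hD694 m hm hmn
      hS347
      hS694 x y z hxy1 hxy2
  · exact rowC2aAB_age7 347 hℓ (by norm_num) M hP n hn h7 hnℓ hD694 a m (by omega) hm han hmn
      hS694 x y z hxy1 hxy2

end Summit.Ventures.AbcSig
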